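import Summits.NavierStokesRegularity.NavierStokesRegularity.Theses.TypeICertificateLadder
import Literature.Analysis.FluidPDE.LeraySelfSimilarCalculus
import Literature.Analysis.FluidPDE.ClassicalSolutionCalculus
import Literature.Analysis.FluidPDE.VectorCalculusProofs
import Literature.Analysis.FluidPDE.TaoEnstrophyLocalisation

/-!
# Crux `Target` = `TypeICertificateLadder.NoTypeIBlowup` (stmt-NavierStokesRegularity-1217), negative side:
# the literal force `0` is load-bearing — part 1/2: the self-similar witness (profile, field, force, no extension)

Negative-side (cdisprove gen 4, D-0016) model refutation, importable (`--supports` stmt-1217).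
Replace the literal `0` force of the crux by a force `f` and keep every other clause in its
energy-class content: `(u, p)` classical for the FORCED system on `[0, T) × ℝ³`
(`IsClassicalNSSolutionOn (Ico 0 T) ν f u p`), datum `u 0` rapidly decaying, `u ∈ L^∞(0, T; L²)`,
`f` jointly smooth on `[0, T) × ℝ³` and in LERAY'S FORCING CLASS `L¹(0, T; L²)` (the class in which
Leray–Hopf solutions with the energy inequality exist; the class of Albritton–Brué–Colombo 2022),
Type-I rate at `T` — conclusion: classical extension past `T` (for the forced system). This
statement, `TargetForcedEnergyClass`, is FALSE (`targetForcedEnergyClass_false`): for ANY smooth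
compactly supported solenoidal profile `U ≠ 0` (here `U = curl(φ e₂)`, `φ` a smooth bump) Leray's
EXACT backward self-similar field `u(t, x) = λ(t) U(λ(t) x)`, `λ = (1 - t)^{-1/2}`, with `p = 0` and
the force DEFINED as the residual `f := ∂ₜu + (u·∇)u - νΔu = λ³ F(λx)`, is a finite-energy
(`‖u(t)‖₂ = λ^{-1/2}‖U‖₂ → 0`), exactly Type-I, exactly self-similar blow-up at `T = 1`, while
`‖f(t)‖₂ = λ^{3/2}‖F‖₂ = (1 - t)^{-3/4}‖F‖₂` is integrable. Contrast §4 `target_selfSimilar`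
(`f = 0`: exact self-similarity is excluded by NRŠ 1996 / Tsai 1998): exact self-similarity is killed
by the EQUATION (the profile Liouville theorem), not by energy-class or rate bookkeeping — a source
term of critical size reinstates it. (The full strict-sense `IsLerayHopfOn 1 ν f (u 0) u` also holds
with `u 1 := 0`, energy equality included, but is not verified here; `L^∞L²` is.)
[cite: Leray1934, (3.11)] [cite: AlbrittonBrueColombo2022, Thm. 1.2–1.3 (forcing class L¹ₜL²ₓ)]
-/

noncomputable section

open MeasureTheory TopologicalSpace Set Function Filter Metric
open scoped Topology RealInnerProductSpace ContDiff Laplacian InnerProductSpace ENNReal NNReal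
open Literature.Analysis.FluidPDE

namespace Summit.NavierStokesRegularity.NavierStokesRegularity.Theorems.Target.Negative

set_option linter.dupNamespace false

/-- Local notation for physical space `ℝ³ = EuclideanSpace ℝ (Fin 3)`. -/
local notation "ℝ³" => EuclideanSpace ℝ (Fin 3)

/-! ## §10.1 A smooth compactly supported solenoidal profile `U = curl(φ e₂) ≠ 0` -/

section Profile

/-- A fixed smooth bump on `ℝ³`: `1` on the closed unit ball, `0` outside the ball of radius `2`. -/
def bump : ContDiffBump (0 : ℝ³) := ⟨1, 2, one_pos, one_lt_two⟩

/-- The vector potential `A(x) = φ(x) e₂`. -/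
def potA : ℝ³ → ℝ³ := fun x => (bump : ℝ³ → ℝ) x • EuclideanSpace.single (2 : Fin 3) (1 : ℝ)

/-- The profile `U = curl A = (∂₁φ, -∂₀φ, 0)`: smooth, compactly supported, divergence free. -/
def profU : ℝ³ → ℝ³ := curl potA

/-- The potential is smooth. -/
theorem contDiff_potA : ContDiff ℝ ∞ potA :=
  (bump.contDiff (n := ⊤)).smul contDiff_const

/-- The potential is compactly supported. -/
theorem hasCompactSupport_potA : HasCompactSupport potA := by
  refine bump.hasCompactSupport.mono fun x hx => ?_
  simp only [mem_support, potA] at hx ⊢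
  intro h0
  exact hx (by rw [h0, zero_smul])

/-- The profile is smooth (`curl = curlCLM ∘ D`). -/
theorem contDiff_profU : ContDiff ℝ ∞ profU := by
  rw [profU, curl_eq_curlCLM_comp]
  exact curlCLM.contDiff.comp (contDiff_potA.fderiv_right (m := ∞) (by simp))

/-- The profile is compactly supported. -/
theorem hasCompactSupport_profU : HasCompactSupport profU := by
  rw [profU, curl_eq_curlCLM_comp]
  exact (hasCompactSupport_potA.fderiv (𝕜 := ℝ)).comp_left (map_zero curlCLM)

/-- The profile is divergence free (`div curl = 0`, `divergence_curl_eq_zero_holds`). -/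
theorem isDivFree_profU : VectorCalculus.IsDivFree profU := fun x =>
  divergence_curl_eq_zero_holds potA (contDiff_infty.1 contDiff_potA 2) x

/-- The derivative of the potential: `DA(y) h = (Dφ(y) h) e₂`. -/
theorem fderiv_potA (y h : ℝ³) :
    fderiv ℝ potA y h = (fderiv ℝ (bump : ℝ³ → ℝ) y h) • EuclideanSpace.single (2 : Fin 3) (1 : ℝ) := by
  have hd : DifferentiableAt ℝ (bump : ℝ³ → ℝ) y :=
    (bump.contDiff (n := 1)).differentiable one_ne_zero y
  unfold potA
  rw [fderiv_smul_const hd]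
  rfl

/-- The second component of the profile is `-∂₀φ`. -/
theorem profU_apply_one (y : ℝ³) :
    profU y 1 = -(fderiv ℝ (bump : ℝ³ → ℝ) y (EuclideanSpace.single (0 : Fin 3) (1 : ℝ))) := by
  simp only [profU, curl, fderiv_potA]
  simp

/-- The profile is not identically zero: otherwise `∂₀φ ≡ 0`, so `φ` would be constant along
`e₀`, contradicting `φ(0) = 1`, `φ(2e₀) = 0`. -/
theorem exists_profU_ne_zero : ∃ y : ℝ³, profU y ≠ 0 := by
  by_contra h
  push Not at h
  set e0 : ℝ³ := EuclideanSpace.single (0 : Fin 3) (1 : ℝ) with he0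
  have hzero : ∀ y, fderiv ℝ (bump : ℝ³ → ℝ) y e0 = 0 := fun y => by
    have h1 := profU_apply_one y
    rw [h y] at h1
    simpa using h1
  -- `s ↦ φ(s e₀)` has zero derivative, hence is constant
  set g : ℝ → ℝ := fun s => (bump : ℝ³ → ℝ) (s • e0) with hg
  have hdiff : Differentiable ℝ (bump : ℝ³ → ℝ) :=
    (bump.contDiff (n := 1)).differentiable one_ne_zero
  have hderiv : ∀ s, HasDerivAt g 0 s := by
    intro s
    have h1 : HasDerivAt (fun s : ℝ => s • e0) e0 s := by
      simpa using (hasDerivAt_id s).smul_const e0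
    have h2 := (hdiff (s • e0)).hasFDerivAt.comp_hasDerivAt s h1
    rw [hzero] at h2
    exact h2
  have hconst : g 2 = g 0 :=
    is_const_of_deriv_eq_zero (fun s => (hderiv s).differentiableAt) (fun s => (hderiv s).deriv) 2 0
  have hg0 : g 0 = 1 := by
    rw [hg]; simp only [zero_smul]
    exact bump.one_of_mem_closedBall (by simp [bump])
  have hg2 : g 2 = 0 := by
    rw [hg]
    refine bump.zero_of_le_dist ?_
    have hn : ‖e0‖ = 1 := by simp [he0]
    rw [dist_zero_right, norm_smul, hn]
    norm_num [bump]
  rw [hg0, hg2] at hconst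
  exact zero_ne_one hconst

/-- A bound for the profile. -/
theorem exists_bound_profU : ∃ M : ℝ, 0 ≤ M ∧ ∀ y, ‖profU y‖ ≤ M := by
  obtain ⟨C, hC⟩ := contDiff_profU.continuous.bounded_above_of_compact_support
    hasCompactSupport_profU
  exact ⟨max C 0, le_max_right _ _, fun y => (hC y).trans (le_max_left _ _)⟩

end Profile

/-! ## §10.2 Leray's exact backward self-similar field with profile `U`, pressure `0`, and the
## force defined as the residual -/

section Field

/-- The self-similar velocity `u(t, x) = λ(t) U(λ(t) x)`, `λ(t) = (1 - t)^{-1/2}` (Leray's backward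
ansatz with `a = ½`, `T = 1`; junk `0` for `t ≥ 1`). -/
def ssVel : ℝ → ℝ³ → ℝ³ := lerayBackward (1 / 2) 1 profU

/-- The scale factor `λ(t) = (√(2 · ½ · (1 - t)))⁻¹ = (1 - t)^{-1/2}`. -/
def lam (t : ℝ) : ℝ := (Real.sqrt (2 * (1 / 2) * (1 - t)))⁻¹

/-- `λ(t) = (1 - t)^{-1/2}`. -/
theorem lam_eq (t : ℝ) : lam t = (Real.sqrt (1 - t))⁻¹ := by
  rw [lam]; norm_num

/-- `λ(t) > 0` for `t < 1`. -/
theorem lam_pos {t : ℝ} (ht : t < 1) : 0 < lam t := by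
  rw [lam_eq]; exact inv_pos.2 (Real.sqrt_pos.2 (by linarith))

/-- `λ(t) ≥ 1` for `0 ≤ t < 1`. -/
theorem one_le_lam {t : ℝ} (ht0 : 0 ≤ t) (ht : t < 1) : 1 ≤ lam t := by
  rw [lam_eq, le_inv_comm₀ one_pos (Real.sqrt_pos.2 (by linarith)), inv_one]
  exact Real.sqrt_le_one.2 (by linarith)

/-- Unfolding the self-similar field. -/
theorem ssVel_apply (t : ℝ) (x : ℝ³) : ssVel t x = lam t • profU (lam t • x) := rfl

/-- The force: the residual `f := ∂ₜu + (u·∇)u - νΔu` of the unforced system with `p = 0`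
(time derivative one-sided within `[0, 1)`, as in `IsClassicalNSSolutionOn`). -/
def ssForce (ν : ℝ) : ℝ → ℝ³ → ℝ³ := fun t x =>
  timeDerivWithin (Ico 0 1) ssVel t x + convect (ssVel t) (ssVel t) x - ν • (Δ (ssVel t)) x

/-- `(u, 0)` is a classical solution of the Navier–Stokes system on `[0, 1) × ℝ³` with viscosity `ν`
and force `ssForce ν` — by DEFINITION of the force; smoothness from
`contDiffOn_uncurry_lerayBackward`, incompressibility from `isDivFree_lerayBackward`. -/
theorem isClassical_ss (ν : ℝ) :
    IsClassicalNSSolutionOn (Ico 0 1) ν (ssForce ν) ssVel (fun _ _ => (0 : ℝ)) where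
  smooth_velocity :=
    (contDiffOn_uncurry_lerayBackward (by norm_num : (0 : ℝ) < 1 / 2) contDiff_profU 1).mono
      (prod_mono Ico_subset_Iio_self Subset.rfl)
  smooth_pressure := contDiffOn_const
  momentum t _ x := by
    have hg : gradient (fun _ : ℝ³ => (0 : ℝ)) x = 0 := by
      simp [gradient]
    rw [hg, sub_zero, ssForce]
    abel
  divFree t _ := isDivFree_lerayBackward isDivFree_profU _ _ _

/-- The datum is the profile itself: `u(0) = U` (`λ(0) = 1`). -/
theorem ssVel_zero : ssVel 0 = profU := by
  funext x
  rw [ssVel_apply]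
  have h : lam 0 = 1 := by rw [lam_eq]; simp
  rw [h, one_smul, one_smul]

/-- Smooth compactly supported fields decay rapidly (Fefferman (4) trivially). -/
theorem hasRapidSpatialDecay_of_smooth_compactSupport {u₀ : ℝ³ → ℝ³} (hsm : ContDiff ℝ ∞ u₀)
    (hc : HasCompactSupport u₀) : HasRapidSpatialDecay u₀ := by
  intro n K
  have hcont : Continuous fun x => (1 + ‖x‖) ^ K * ‖iteratedFDeriv ℝ n u₀ x‖ :=
    ((continuous_const.add continuous_norm).pow K).mul
      (hsm.continuous_iteratedFDeriv (m := n) (mod_cast le_top)).norm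
  have hsupp : HasCompactSupport fun x => (1 + ‖x‖) ^ K * ‖iteratedFDeriv ℝ n u₀ x‖ :=
    ((hc.iteratedFDeriv n).norm).mul_left
  obtain ⟨C, hC⟩ := hcont.bounded_above_of_compact_support hsupp
  refine ⟨C, fun x => ?_⟩
  have h := hC x
  rwa [Real.norm_eq_abs, abs_of_nonneg (by positivity)] at h

/-- The datum `u 0 = U` is rapidly decaying. -/
theorem hasRapidSpatialDecay_ssVel_zero : HasRapidSpatialDecay (ssVel 0) := by
  rw [ssVel_zero]
  exact hasRapidSpatialDecay_of_smooth_compactSupport contDiff_profU hasCompactSupport_profU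

/-- **Exactly Type-I**: `‖u(t, x)‖ ≤ ‖U‖_∞ /√(1 - t)` for all `t < 1`. -/
theorem isTypeIBlowup_ss : IsTypeIBlowup ssVel 1 := by
  obtain ⟨M, hM0, hM⟩ := exists_bound_profU
  refine ⟨M, ?_⟩
  have hIio : ∀ᶠ t in 𝓝[<] (1 : ℝ), t < 1 := eventually_nhdsWithin_of_forall fun t ht => ht
  filter_upwards [hIio] with t ht x
  rw [ssVel_apply, norm_smul, Real.norm_of_nonneg (lam_pos ht).le, lam_eq, div_eq_inv_mul]
  exact mul_le_mul_of_nonneg_left (hM _) (inv_nonneg.2 (Real.sqrt_nonneg _))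

/-- `λ(t) → ∞` as `t ↑ 1`. -/
theorem tendsto_lam_atTop : Tendsto lam (𝓝[<] (1 : ℝ)) atTop := by
  have h1 : Tendsto (fun t : ℝ => 1 - t) (𝓝[<] (1 : ℝ)) (𝓝[>] (0 : ℝ)) := by
    refine tendsto_nhdsWithin_iff.2 ⟨?_, ?_⟩
    · have h : Tendsto (fun t : ℝ => 1 - t) (𝓝 (1 : ℝ)) (𝓝 (1 - 1)) :=
        (continuous_const.sub continuous_id).tendsto 1
      rw [sub_self] at h
      exact h.mono_left nhdsWithin_le_nhds
    · filter_upwards [self_mem_nhdsWithin] with t ht using sub_pos.2 (mem_Iio.1 ht)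
  have h2 : Tendsto Real.sqrt (𝓝[>] (0 : ℝ)) (𝓝[>] (0 : ℝ)) := by
    refine tendsto_nhdsWithin_iff.2 ⟨?_, ?_⟩
    · have h := Real.continuous_sqrt.tendsto (0 : ℝ)
      rw [Real.sqrt_zero] at h
      exact h.mono_left nhdsWithin_le_nhds
    · filter_upwards [self_mem_nhdsWithin] with x hx using Real.sqrt_pos.2 (mem_Ioi.1 hx)
  have h3 := tendsto_inv_nhdsGT_zero.comp (h2.comp h1)
  refine h3.congr fun t => ?_
  simp [lam_eq, Function.comp]

/-- **The field does not extend classically past `t = 1`** (for any force): along the curve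
`x_t = λ(t)⁻¹ y*` (inside a fixed ball), `‖u(t, x_t)‖ = λ(t)‖U(y*)‖ → ∞`, while a classical
extension would be continuous, hence bounded, on the compact `[0, 1] × B̄(0, ‖y*‖)`. -/
theorem not_hasSmoothExtensionPast_ss (ν : ℝ) (f : ℝ → ℝ³ → ℝ³) :
    ¬ HasSmoothExtensionPast ν f ssVel 1 := by
  rintro ⟨T', hT', u', p', hcl, hagree⟩
  obtain ⟨y, hy⟩ := exists_profU_ne_zero
  have hypos : 0 < ‖profU y‖ := norm_pos_iff.2 hy
  -- the extension is bounded on the compact `[0, 1] × closedBall 0 ‖y‖`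
  set K : Set (ℝ × ℝ³) := Icc 0 1 ×ˢ closedBall (0 : ℝ³) ‖y‖ with hK
  have hKc : IsCompact K := isCompact_Icc.prod (isCompact_closedBall _ _)
  have hKsub : K ⊆ Ico 0 T' ×ˢ univ := prod_mono (Icc_subset_Ico_right hT') (subset_univ _)
  have hcont : ContinuousOn (uncurry u') K := (hcl.smooth_velocity.continuousOn).mono hKsub
  obtain ⟨B, hB⟩ := hKc.exists_bound_of_continuousOn hcont
  -- along the curve the values are `λ(t) • U y`, of norm `λ(t) ‖U y‖ ≤ B`
  have hle : ∀ t ∈ Ico (0 : ℝ) 1, lam t * ‖profU y‖ ≤ B := by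
    intro t ht
    have hlt : 0 < lam t := lam_pos ht.2
    set x : ℝ³ := (lam t)⁻¹ • y with hx
    have hxK : (t, x) ∈ K := by
      refine mk_mem_prod ⟨ht.1, ht.2.le⟩ ?_
      rw [mem_closedBall, dist_zero_right, hx, norm_smul, Real.norm_of_nonneg (inv_nonneg.2 hlt.le)]
      have h1 : (lam t)⁻¹ ≤ 1 := inv_le_one_of_one_le₀ (one_le_lam ht.1 ht.2)
      exact mul_le_of_le_one_left (norm_nonneg _) h1
    have hval : u' t x = lam t • profU y := by
      rw [hagree t ht, ssVel_apply, hx, smul_smul, mul_inv_cancel₀ hlt.ne', one_smul]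
    have h := hB (t, x) hxK
    rw [uncurry_apply_pair, hval, norm_smul, Real.norm_of_nonneg hlt.le] at h
    exact h
  -- but `λ(t) ‖U y‖ → ∞`
  have hlim : Tendsto (fun t => lam t * ‖profU y‖) (𝓝[<] (1 : ℝ)) atTop :=
    tendsto_lam_atTop.atTop_mul_const hypos
  obtain ⟨t, ht, hbig⟩ := ((hlim.eventually_gt_atTop B).and (Ioo_mem_nhdsLT one_pos)).exists
  exact absurd (hle t ⟨hbig.1.le, hbig.2⟩) (not_le.2 ht)

end Field

end Summit.NavierStokesRegularity.NavierStokesRegularity.Theorems.Target.Negative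

end
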